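/-
Origin: expansion seat `planner-pub-hodgecm-pv05-0`, handover 2026-08-18T03:37:51Z (`HOME/pub-hodgecm-pv05/lean/Pv05/CharExt.lean`, md5 5de5a31e, 242 lines);
landed by the gen-5 packager in gate run 19 as `HodgeCM/PerL34/CharExt.lean` (verbatim).
-/
/-
Origin: HOME/pub-hodgecm-pv05/lean/Pv05/CharExt.lean — session planner-pub-hodgecm-pv05-0 (unit pub-hodgecm-pv05,
DAG-NODE PROVER #05 of 15).  Intended final place: `HodgeCM/PerL34/CharExt.lean`
(namespace `HodgeCM.PerL34.CharExt`; rename the module `Pv05.CharExt` ↦ `HodgeCM.PerL34.CharExt`).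
DAG node N30 (HOME/LEMMAS.md §1): PerL v5 Lemma 4.2(a) `lem:chars`, tex ll. 528–529, proof ll. 537–542.
Imports Mathlib only.  Every declaration below is closed (no placeholders, no new constants).
-/
import Mathlib
import Literature.Topology.Algebra.CircleCharacterExtension

set_option autoImplicit false

/-!
# PerL v5 Lemma 4.2(a) — the character-extension engine (DAG node N30)

**The node (verbatim, tex ll. 528–529).** "(a) For every `e=(e_b)_b\in\Z^{\{b\}}` there is an automorphic
character `\chi'` of `[\U(1)]=\U(1)(L_0)\backslash\A^1_L` with `\chi'_b(u)=u^{e_b}` at every real place."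

**Its proof (verbatim, tex ll. 537–542).** "(a) `\U(1)(L_0)=\{x\in L^\times:x\bar x=1\}`; its intersection with
`\U(1)(L_0\otimes\R)\times K'` for a compact open `K'\subset \A^1_{L,f}` contained in the unit ideles consists of
elements of `\mathcal O_L^\times` all of whose conjugates have absolute value `1`, i.e. of roots of unity
(Kronecker), and is trivial once `K'` is small; so the character `(u_\infty,k)\mapsto\prod_bu_b^{e_b}` of
`\U(1)(L_0\otimes\R)\times K'` descends to the open subgroup `\U(1)(L_0)\cdot(\U(1)(L_0\otimes\R)\times K')` of
`\A^1_L` (trivial on `\U(1)(L_0)`), which has finite index (`[\U(1)]` is compact), and extends to a character of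
`\A^1_L` trivial on `\U(1)(L_0)` by divisibility of the circle group."

**What this file proves (kernel-checked, Mathlib only).**  The argument of ll. 539–542 is a statement about an
arbitrary commutative topological group `G` (`= \A^1_L`), a subgroup `Γ` (`= \U(1)(L_0)`), an OPEN subgroup `H`
(`= \U(1)(L_0\otimes\R)\times K'`) and a continuous character `ψ₀ : H →* Circle` (`= (u_\infty,k)\mapsto\prod_b
u_b^{e_b}`) trivial on `Γ ⊓ H`.  We prove it in that generality:

* §1 `zpow_surjective`, `instDivisibleByAdditiveCircleInt`, `baer_circle` — the circle group is divisible, hence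
  (Baer) an injective `ℤ`-module ("divisibility of the circle group", l. 542);
* §2 `exists_extension` — EVERY character of a subgroup of a commutative group extends to the whole group
  (algebraic; this is "extends … by divisibility", l. 541–542; NOTE: PerL's remark "which has finite index
  (`[\U(1)]` is compact)" is not needed for the extension — injectivity of divisible abelian groups does not use
  finite index — so the compactness of `[\U(1)]` is NOT an input of node N30 in this formalisation);
* §3 `exists_descent` — "descends to the open subgroup `Γ·H` (trivial on `Γ`)", ll. 540–541: a character of `H`
  trivial on `Γ ⊓ H` is the restriction of a character of `G ⧸ Γ`-type, i.e. of a character of `G` trivial on `Γ`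
  (we descend to `H.map (QuotientGroup.mk' Γ) ≤ G ⧸ Γ` and extend there, which does both steps at once);
* §4 `continuous_of_continuous_restrict` — a homomorphism out of a topological group whose restriction to an OPEN
  subgroup is continuous is continuous (this is why the extended character is automatically continuous = a
  character of the topological group `\A^1_L`);
* §5 `exists_openSubgroup_disjoint_finite` — "and is trivial once `K'` is small", l. 539: in a `T1` group in
  which the open subgroups form a basis of neighbourhoods of `1` (e.g. the finite ideles `\A^1_{L,f}`), every
  finite set not containing `1` (here: the finite-idele components of the non-trivial roots of unity of `L`,
  finite by Kronecker = the carver's PROVED core `HodgeCM.PerL34.N30_core_kronecker`, file `CharsCore.lean`) is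
  avoided by some open subgroup `K'`;
* §6 `N30_engine` — the assembled statement: `∃ χ : G →* Circle` continuous, trivial on `Γ`, restricting to `ψ₀`
  on `H`.

**What is NOT here (LEMMAS.md §3 D3).** The adelic dictionary `G = \A^1_L` (a locally compact commutative group),
`Γ = \U(1)(L_0)`, `H = \U(1)(L_0\otimes\R)\times K'` open, `ψ₀` continuous and trivial on `K'`, and the
identification "`Γ ∩ H ⊂ \mathcal O_L^\times` with all conjugates of absolute value 1" (number theory of `L`;
its conclusion "= roots of unity" is the carver's `N30_core_kronecker`, PROVED).  With that dictionary,
Lemma 4.2(a) = `N30_engine` + `exists_openSubgroup_disjoint_finite` + `N30_core_kronecker`.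

**Re-use for node N15** (existence of the splitting characters `μ_i`, tex ll. 304–314; carver's typed core
`N15_core_charExtension` = extension from a CLOSED subgroup `B` of a locally compact abelian group, Deitmar–Echterhoff
Cor. 3.6.2).  For the groups at hand Pontryagin duality can be avoided: `B = L^\times\A^\times_{L_0}L^\times_\infty/
L^\times` is not open, but `B·K'` is (it contains the archimedean component), and a continuous `χ : B →* Circle` is
trivial on `B ⊓ K'` for `K'` small because the circle has no small subgroups (node N31g core); then §3 + §2 + §4
apply verbatim PROVIDED the descended character on `B·K'` is continuous, which needs the extra topological input
"`B × K' → B·K'` is open at `1`" (true for ideles: product topology `\A^\times = \A^\times_\infty\times\A^\times_f`).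
That last input is the N15 holder's; it is not asserted here.
-/

noncomputable section

namespace HodgeCM
namespace PerL34
namespace CharExt

open Topology Filter

/-! ## §1  The circle group is divisible ("divisibility of the circle group", tex l. 542) -/

/-- Every element of the unit circle has an `n`-th root for `n ≠ 0`: `z = exp(i·arg z) = (exp(i·arg z / n))^n`. -/
theorem zpow_surjective {n : ℤ} (hn : n ≠ 0) :
    Function.Surjective (fun z : Circle => z ^ n) := by
  intro z
  refine ⟨Circle.exp (Complex.arg z / n), ?_⟩
  have hn' : (n : ℝ) ≠ 0 := Int.cast_ne_zero.mpr hn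
  show Circle.exp (Complex.arg z / n) ^ n = z
  rw [← Circle.exp_intCast_mul, mul_div_cancel₀ _ hn', Circle.exp_arg]

/-- The (additively written) circle group is a divisible abelian group. -/
instance instDivisibleByAdditiveCircleInt : DivisibleBy (Additive Circle) ℤ :=
  divisibleByOfSMulRightSurj (A := Additive Circle) ℤ fun {n} hn => by
    intro x
    obtain ⟨w, hw⟩ := zpow_surjective hn (Additive.toMul x)
    refine ⟨Additive.ofMul w, ?_⟩
    show n • Additive.ofMul w = x
    rw [← ofMul_zpow]
    have hw' : w ^ n = Additive.toMul x := hw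
    rw [hw']
    rfl

/-- Baer's criterion holds for the circle group: it is an injective `ℤ`-module
(`Module.Baer.of_divisible`, Mathlib). -/
alias baer_circle := Literature.Topology.Algebra.baer_additiveCircle

/-! ## §2  Algebraic extension of characters (tex ll. 541–542, without "finite index") -/

/-- **Extension.** Every character `χ : B →* Circle` of a subgroup `B` of a commutative group `G` is the
restriction of a character of `G`.  (Injectivity of the divisible group `Circle` in the category of abelian
groups; no finite-index or compactness hypothesis is needed.) -/
theorem exists_extension {G : Type*} [CommGroup G] (B : Subgroup G) (χ : B →* Circle) :
    ∃ χ' : G →* Circle, ∀ b : B, χ' b = χ b := by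
  have hinj : Function.Injective (MonoidHom.toAdditive B.subtype) := fun x y h => by
    simpa using h
  obtain ⟨g, hg⟩ := baer_circle.extension_property_addMonoidHom
    (MonoidHom.toAdditive B.subtype) hinj (MonoidHom.toAdditive χ)
  refine ⟨MonoidHom.toAdditive.symm g, fun b => ?_⟩
  have h := DFunLike.congr_fun hg (Additive.ofMul (b : B))
  -- `h : g (ofMul ↑b) = ofMul (χ b)` up to the definitional identifications `Additive _ = _`
  exact congrArg Additive.toMul h

/-- The same, for an injective homomorphism `f : B →* G` in place of a subgroup. -/
theorem exists_extension_of_injective {B G : Type*} [CommGroup B] [CommGroup G] (f : B →* G)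
    (hf : Function.Injective f) (χ : B →* Circle) :
    ∃ χ' : G →* Circle, ∀ b : B, χ' (f b) = χ b := by
  have hinj : Function.Injective (MonoidHom.toAdditive f) := fun x y h => by
    have h' : f (Additive.toMul x) = f (Additive.toMul y) := by simpa using h
    exact Additive.toMul.injective (hf h')
  obtain ⟨g, hg⟩ := baer_circle.extension_property_addMonoidHom
    (MonoidHom.toAdditive f) hinj (MonoidHom.toAdditive χ)
  refine ⟨MonoidHom.toAdditive.symm g, fun b => ?_⟩
  have h := DFunLike.congr_fun hg (Additive.ofMul b)
  exact congrArg Additive.toMul h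

/-! ## §3  Descent modulo `Γ` (tex ll. 540–541: "descends to the open subgroup `Γ·H` … trivial on `Γ`") -/

/-- **Descent + extension.** Let `Γ, H ≤ G` (commutative) and let `ψ₀ : H →* Circle` be trivial on `Γ ⊓ H`.
Then there is a character `χ` of `G`, trivial on `Γ`, whose restriction to `H` is `ψ₀`.
Proof: `ψ₀` factors through the image `H̄` of `H` in `G ⧸ Γ` (its kernel contains `H ⊓ Γ`), the character of
`H̄` extends to `G ⧸ Γ` by §2, and we pull back along `G → G ⧸ Γ`. -/
theorem exists_descent {G : Type*} [CommGroup G] (Γ H : Subgroup G) (ψ₀ : H →* Circle)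
    (hψ : ∀ x : H, (x : G) ∈ Γ → ψ₀ x = 1) :
    ∃ χ : G →* Circle, (∀ γ : G, γ ∈ Γ → χ γ = 1) ∧ ∀ x : H, χ x = ψ₀ x := by
  classical
  -- the projection `π : G → G ⧸ Γ` and the induced surjection `H → H.map π`
  let π : G →* G ⧸ Γ := QuotientGroup.mk' Γ
  let p : H →* H.map π := π.subgroupMap H
  have hp : Function.Surjective p := π.subgroupMap_surjective H
  -- `ker p ≤ ker ψ₀`: an element of `H` dies in `G ⧸ Γ` iff it lies in `Γ`
  have hker : p.ker ≤ ψ₀.ker := by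
    intro x hx
    rw [MonoidHom.mem_ker] at hx ⊢
    apply hψ x
    have hx' : (π (x : G)) = 1 := congrArg Subtype.val hx
    exact (QuotientGroup.eq_one_iff (x : G)).mp hx'
  -- factor `ψ₀` through `p`
  let ψbar : H.map π →* Circle := p.liftOfSurjective hp ⟨ψ₀, hker⟩
  have hψbar : ∀ x : H, ψbar (p x) = ψ₀ x := fun x =>
    p.liftOfRightInverse_comp_apply (Function.surjInv hp) (Function.rightInverse_surjInv hp) ⟨ψ₀, hker⟩ x
  -- extend `ψbar` from `H.map π ≤ G ⧸ Γ` to `G ⧸ Γ` (§2) and pull back to `G`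
  obtain ⟨χbar, hχbar⟩ := exists_extension (H.map π) ψbar
  refine ⟨χbar.comp π, ?_, ?_⟩
  · intro γ hγ
    have : π γ = 1 := (QuotientGroup.eq_one_iff γ).mpr hγ
    rw [MonoidHom.comp_apply, this, map_one]
  · intro x
    have h1 : χbar (π (x : G)) = χbar ((p x : H.map π) : G ⧸ Γ) := rfl
    rw [MonoidHom.comp_apply, h1, hχbar (p x), hψbar x]

/-! ## §4  Continuity from an open subgroup -/

/-- A homomorphism from a topological group to a topological monoid whose restriction to an OPEN subgroup is
continuous is continuous.  (Continuity at `1` suffices, and near `1` the homomorphism agrees with its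
restriction.) -/
theorem continuous_of_continuous_restrict {G : Type*} [Group G] [TopologicalSpace G] [IsTopologicalGroup G]
    {M : Type*} [Monoid M] [TopologicalSpace M] [ContinuousMul M]
    (χ : G →* M) (H : Subgroup G) (hH : IsOpen (H : Set G))
    (hc : Continuous fun x : H => χ x) : Continuous χ := by
  apply continuous_of_continuousAt_one χ
  have hemb : IsOpenEmbedding ((↑) : H → G) := hH.isOpenEmbedding_subtypeVal
  rw [ContinuousAt, ← show ((1 : H) : G) = 1 from rfl, ← hemb.map_nhds_eq, Filter.tendsto_map'_iff]
  have h1 : Filter.Tendsto (fun x : H => χ x) (𝓝 1) (𝓝 (χ ((1 : H) : G))) := hc.tendsto 1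
  exact h1

/-! ## §5  "Trivial once `K'` is small" (tex l. 539) -/

/-- In a `T1` topological group in which the open subgroups form a basis of neighbourhoods of `1` (e.g. a
non-archimedean group such as the finite ideles), every finite set not containing `1` is disjoint from some open
subgroup.  Applied to the (finitely many, by Kronecker = `N30_core_kronecker`) non-trivial roots of unity of
`L`, this is "`Γ ∩ (U(1)(L_0\otimes\R) × K')` is trivial once `K'` is small". -/
theorem exists_openSubgroup_disjoint_finite {G : Type*} [Group G] [TopologicalSpace G] [T1Space G]
    (basis : ∀ U ∈ 𝓝 (1 : G), ∃ K : OpenSubgroup G, (K : Set G) ⊆ U)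
    (F : Set G) (hF : F.Finite) (h1 : (1 : G) ∉ F) :
    ∃ K : OpenSubgroup G, Disjoint (K : Set G) F := by
  have hU : Fᶜ ∈ 𝓝 (1 : G) := hF.isClosed.isOpen_compl.mem_nhds (Set.mem_compl h1)
  obtain ⟨K, hK⟩ := basis _ hU
  exact ⟨K, Set.disjoint_left.mpr fun x hx hxF => hK hx hxF⟩

/-- Consequence used at l. 539–540: if `Γ ⊓ H₀` is finite (Kronecker) then for every open subgroup `K ≤ H₀`
missing its non-trivial elements, `Γ ⊓ K` is trivial — so ANY character of `K` is trivial on `Γ ⊓ K`. -/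
theorem inf_eq_bot_of_disjoint {G : Type*} [Group G] (Γ H₀ K : Subgroup G) (hK : K ≤ H₀)
    (hdisj : Disjoint (K : Set G) (((Γ ⊓ H₀ : Subgroup G) : Set G) \ {1})) : Γ ⊓ K = ⊥ := by
  rw [eq_bot_iff]
  intro x hx
  rw [Subgroup.mem_bot]
  by_contra hne
  have hxK : x ∈ (K : Set G) := hx.2
  have hxF : x ∈ ((Γ ⊓ H₀ : Subgroup G) : Set G) \ {1} :=
    ⟨⟨hx.1, hK hx.2⟩, by simpa using hne⟩
  exact Set.disjoint_left.mp hdisj hxK hxF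

/-! ## §6  The engine of Lemma 4.2(a) (tex ll. 539–542) -/

/-- **N30 engine** (PerL v5 Lemma 4.2(a) proof, tex ll. 539–542, for an arbitrary commutative topological
group).  `G` = `\A^1_L`, `Γ` = `\U(1)(L_0)`, `H` = `\U(1)(L_0\otimes\R)\times K'` (open), `ψ₀(u_\infty,k)=\prod_b
u_b^{e_b}` (continuous, trivial on `Γ ⊓ H` once `K'` is small: §5 + Kronecker).  Conclusion: a CONTINUOUS
character `χ` of `G`, trivial on `Γ` (i.e. a character of `[\U(1)] = Γ\backslash G`), with `χ|_H = ψ₀` (i.e.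
`\chi'_b(u)=u^{e_b}` at every real place and `χ` trivial on `K'`). -/
theorem N30_engine {G : Type*} [CommGroup G] [TopologicalSpace G] [IsTopologicalGroup G]
    (Γ H : Subgroup G) (hH : IsOpen (H : Set G)) (ψ₀ : H →* Circle) (hψc : Continuous ψ₀)
    (hψ : ∀ x : H, (x : G) ∈ Γ → ψ₀ x = 1) :
    ∃ χ : G →* Circle, Continuous χ ∧ (∀ γ : G, γ ∈ Γ → χ γ = 1) ∧ ∀ x : H, χ x = ψ₀ x := by
  obtain ⟨χ, hΓ, hHχ⟩ := exists_descent Γ H ψ₀ hψ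
  refine ⟨χ, ?_, hΓ, hHχ⟩
  apply continuous_of_continuous_restrict χ H hH
  have : (fun x : H => χ x) = ψ₀ := funext hHχ
  rw [this]
  exact hψc

/-- The engine packaged as a `ContinuousMonoidHom` into the circle (a unitary character of the topological
group `G`), trivial on `Γ` — hence factoring through `G ⧸ Γ` — and extending `ψ₀`. -/
theorem N30_engine' {G : Type*} [CommGroup G] [TopologicalSpace G] [IsTopologicalGroup G]
    (Γ H : Subgroup G) (hH : IsOpen (H : Set G)) (ψ₀ : H →* Circle) (hψc : Continuous ψ₀)
    (hψ : ∀ x : H, (x : G) ∈ Γ → ψ₀ x = 1) :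
    ∃ χ : ContinuousMonoidHom G Circle, Γ ≤ (χ : G →* Circle).ker ∧ ∀ x : H, χ x = ψ₀ x := by
  obtain ⟨χ, hc, hΓ, hHχ⟩ := N30_engine Γ H hH ψ₀ hψc hψ
  refine ⟨⟨χ, hc⟩, fun γ hγ => ?_, fun x => ?_⟩
  · exact (MonoidHom.mem_ker).mpr (hΓ γ hγ)
  · exact hHχ x

end CharExt
end PerL34
end HodgeCM

end
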